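import Summits.CriticalPhenomena.PercolationContinuityZ3.Theorems.PercNearOneGluingNoHeavyQuantShapeForestTwoLo
import Summits.CriticalPhenomena.PercolationContinuityZ3.Theorems.PercNearOneGluingNoHeavyQuantLongTailQuintHub
import Summits.CriticalPhenomena.PercolationContinuityZ3.Theorems.PercNearOneGluingNoHeavyQuantShapeForestLong4
import Summits.CriticalPhenomena.PercolationContinuityZ3.Theorems.PercNearOneGluingNoHeavyQuantPieceBlobLongHub
import HarnessLib

/-!
# QUANT lane R8, T-DEC: EVERY FOREST OF AT MOST FIVE GLUED SIBLINGS `R^lo[qᵢ](R^K[gᵢ])` OF A COMMON LONG-TAIL SHAPE `lo < K ≤ 4lo`, ANY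
# PARAMETERS, IS SDEC AT EVERY TREE-OK FLOOR `x ≤ min qᵢgᵢ` — ORACLE-FREE (census-1 gen 35; `sdec_shapeForests_five_long` of the same seat with the
# bound `4` replaced by `5`, the new base being the width-5 hub `sdec_sHub_five_upTo4`)

builds on p205010 (kernel theorem, internal audit signed; external expert review pending)

Support file (`--supports stmt-CriticalPhenomena-4575`), QUANT lane seat prim-quant-census-1 (gen 35); memo
`run/shared/lean/prim/quant/prim-quant-census-1/g35/QUADHUB-G35.md` §5.  Theorems only (no definitions), standard axioms, no sorries.  VERBATIM twin
of `…QuantShapeForestLong4` for the states `|P| + |L| ≤ 5` of g31/g32's piece expansion, whose bases are now the hubs of widths 2–5 of every shape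
`lo < K ≤ 4lo` at every gate `γ ≥ lo/K` (`sdec_sHub_upToFive_upTo4`, `…QuantLongTailQuintHub`) and g33's `sdec_pieceBlob_long`.
* **`shapeForest_inv_long5`**, **`sdec_shapeForest_long5`**, `sdec_shapeForest_long5_append`, **`sdec_shapeForests_five_long`** (every forest of ≤ 5
  glued siblings `R^lo(R^K)` of one shape `lo < K ≤ 4lo`, ANY `0 < qᵢ, gᵢ < 1`, every floor `0 < x ≤ min qᵢgᵢ`), **`sdec_shapeForests_long_of_fiveTight`**
  (any number of glued siblings of the shape, at most FIVE tight), **`sdec_forest_fiveTightCore`** (node-shaped).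

HONEST STATUS.  Widths `≥ 6` with `K > 2lo` stay open at the forest level, `K > 4lo` at the hub level; `SiblingStep`, `GluedDominatedMass`,
`SDECConvClosed`, `FarTreeRow` OPEN; RATE class (log\*) / honest sentence of `run/shared/lean/prim/quant/README.md` unchanged.  [this work].  Nothing
here is cited as a published result.  The gluing rows served [cite: KozmaNitzan2024, Conjecture 3 (p. 15)]; product measure [cite: Grimmett1999, §1.3 p. 10].
-/



noncomputable section

open scoped BigOperators

namespace Summit.CriticalPhenomena.PercolationContinuityZ3.Theorems
namespace Quant
namespace LawDec

open Finset

/-- the point mass `δ_K` -/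
local notation3 "δ[" K "]" => (fun k : ℕ => if k = (K : ℕ) then (1 : ℝ) else 0)

/-- the FAR-GIANT PIECE / sub-forest law of shape `(lo, K)`: `S(γ) = {lo: 1−γ, lo+K: γ}` -/
local notation3 "SP[" lo ", " K ", " a "]" => (fun h : ℕ => (1 - (a : ℝ)) * (if h = (lo : ℕ) then (1 : ℝ) else 0) +
  (a : ℝ) * (if h = (lo : ℕ) + (K : ℕ) then (1 : ℝ) else 0))

/-! ### The expansion for forests of at most five glued siblings of shape `(lo, K)`, `K ≤ 4lo` -/

/-- **THE INVARIANT** of the k-fold piece expansion for glued siblings of shape `(lo, K)` (`lo < K ≤ 4lo`) on the states `|P| + |L| ≤ 5`,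
`G = sHub P ∗ flaw L`: (1) law facts (mean `Σ_P (lo + Kγ) + fmean L`); (2) `G` SDEC unless `|P| = 1 ∧ L = []`; (3) `G ∗ gate δ_B(θ)` SDEC for every
big heavy blob `2lo ≤ Bθ`, `θ < 1`, `x ≤ θ` (`B = lo+K`).  Hubs of widths 2–5 (`sdec_sHub_upToFive_upTo4`) and the long piece beside a blob
(`sdec_pieceBlob_long`) are the base; the width bound `|P| + |L| ≤ 5` is preserved by both recursive calls. [this work] -/
theorem shapeForest_inv_long5 (lo K : ℕ) (hloK : lo < K) (hK4 : K ≤ 4 * lo) {x : ℝ} (hx0 : 0 < x) (hx1 : x < 1) : ∀ L : List Sib,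
    (∀ s ∈ L, s.M = lo + K ∧ 0 < s.q ∧ s.q < 1 ∧ ∃ g : ℝ, 0 < g ∧ g < 1 ∧ s.ρ = SP[lo, K, g] ∧
      2 * (lo : ℝ) ≤ s.q * ((lo : ℝ) + K * g) ∧ x ≤ s.q * g) →
    ∀ P : List ℝ, (∀ γ ∈ P, (lo : ℝ) ≤ K * γ ∧ γ < 1 ∧ x * ((lo : ℝ) + K) ≤ lo + K * γ) → P.length + L.length ≤ 5 →
      ((∀ h, 0 ≤ lconv ((lo + K) * P.length) (ftop L) (sHub lo K P) (flaw L) h) ∧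
        (∀ h, (lo + K) * P.length + ftop L < h → lconv ((lo + K) * P.length) (ftop L) (sHub lo K P) (flaw L) h = 0) ∧
        ∑ h ∈ Finset.range ((lo + K) * P.length + ftop L + 1), lconv ((lo + K) * P.length) (ftop L) (sHub lo K P) (flaw L) h = 1 ∧
        ∑ h ∈ Finset.range ((lo + K) * P.length + ftop L + 1), (h : ℝ) * lconv ((lo + K) * P.length) (ftop L) (sHub lo K P) (flaw L) h
          = (P.map (fun γ => (lo : ℝ) + K * γ)).sum + fmean L) ∧
      ((P.length ≠ 1 ∨ L ≠ []) → SDEC x ((lo + K) * P.length + ftop L) (lconv ((lo + K) * P.length) (ftop L) (sHub lo K P) (flaw L))) ∧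
      (∀ θ : ℝ, 2 * (lo : ℝ) ≤ ((lo : ℝ) + K) * θ → θ < 1 → x ≤ θ →
        SDEC x ((lo + K) * P.length + ftop L + (lo + K))
          (lconv ((lo + K) * P.length + ftop L) (lo + K) (lconv ((lo + K) * P.length) (ftop L) (sHub lo K P) (flaw L)) (gate δ[lo + K] θ)))
  | [], _ => by
    intro P hP hlen
    have hlo : 1 ≤ lo := by omega
    have hloR : (1 : ℝ) ≤ lo := by exact_mod_cast hlo
    have hKR : (lo : ℝ) < K := by exact_mod_cast hloK
    have hK0 : (0 : ℝ) < K := by linarith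
    have hpos : ∀ γ ∈ P, 0 ≤ γ := fun γ h => by nlinarith [(hP γ h).1, hK0, hloR]
    have hP01 : ∀ γ ∈ P, 0 ≤ γ ∧ γ ≤ 1 := fun γ h => ⟨hpos γ h, (hP γ h).2.1.le⟩
    obtain ⟨a0, aM, a1, am⟩ := sHub_laws lo K P hP01
    have eG : lconv ((lo + K) * P.length) (ftop []) (sHub lo K P) (flaw []) = sHub lo K P := by
      funext h; exact lconv_delta_right _ _ _ aM h
    have eT : (lo + K) * P.length + ftop [] = (lo + K) * P.length := rfl
    rw [eG, eT]
    have hfm : fmean [] = 0 := rfl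
    rw [hfm, add_zero]
    have hlen' : P.length ≤ 5 := by simpa using hlen
    obtain ⟨hlo', _⟩ := shape_sum_bounds lo K x P (fun γ h => ⟨(hP γ h).2.1, (hP γ h).2.2⟩)
    have hta : x * (((lo + K) * P.length : ℕ) : ℝ) ≤ (P.map (fun γ => (lo : ℝ) + K * γ)).sum := by push_cast; linarith
    have c2 : (P.length ≠ 1 ∨ ([] : List Sib) ≠ []) → SDEC x ((lo + K) * P.length) (sHub lo K P) := by
      intro hc
      have hne : P.length ≠ 1 := hc.elim id (fun h => absurd rfl h)
      rcases Nat.lt_or_ge P.length 2 with hlt | hge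
      · have h0 : P.length = 0 := by omega
        rw [h0, Nat.mul_zero]
        intro q _ _ j' hj'
        omega
      · exact sdec_sHub_upToFive_upTo4 lo K hloK hK4 hx0 P ⟨by omega, by omega⟩ hP
    refine ⟨⟨a0, aM, a1, am⟩, c2, fun θ hθ hθ1 hxθ => ?_⟩
    by_cases h1 : P.length = 1
    · -- a lone far-giant piece beside a big heavy blob: `sdec_pieceBlob_long`
      obtain ⟨γ, rfl⟩ : ∃ γ, P = [γ] := by
        rcases P with _ | ⟨γ, _ | ⟨γ', P'⟩⟩
        · simp at h1
        · exact ⟨γ, rfl⟩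
        · simp at h1
      have hγ := hP γ (by simp)
      have cM : ∀ h, lo + K < h → SP[lo, K, γ] h = 0 := (sp_laws lo K (hpos γ (by simp)) hγ.2.1.le).2.1
      have e0 : sHub lo K [γ] = SP[lo, K, γ] := funext fun h => lconv_delta_left _ (lo + K) _ cM h
      have e1 : (lo + K) * [γ].length = lo + K := by simp
      rw [e1, e0, lconv_comm (lo + K) (lo + K), show lo + K + (lo + K) = 2 * lo + 2 * K by ring]
      exact sdec_pieceBlob_long lo K hloK hK4 hx0 hγ.1 hγ.2.1 (by linarith) hθ1 hθ hxθ hγ.2.2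
    · exact (sdec_blob_step (lo + K) hx0 hx1 hxθ hθ1.le a0 aM a1 am hta (c2 (Or.inl h1))).2.2.2.2
  | s :: L, hL => by
    intro P hP hlen
    have hlo : 1 ≤ lo := by omega
    have hK1 : 1 ≤ K := by omega
    have hloR : (1 : ℝ) ≤ lo := by exact_mod_cast hlo
    have hKR : (lo : ℝ) < K := by exact_mod_cast hloK
    have hB0 : (0 : ℝ) < (lo : ℝ) + K := by linarith
    have hK0 : (0 : ℝ) < K := by linarith
    have hlenL : P.length + L.length ≤ 5 := by simp only [List.length_cons] at hlen; omega
    have hlenQ : (P.length + 1) + L.length ≤ 5 := by simp only [List.length_cons] at hlen; omega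
    obtain ⟨hM, hq0, hq1, g, hg0, hg1, hρ, hm, hxg⟩ := hL s (by simp)
    have hL' : ∀ s' ∈ L, s'.M = lo + K ∧ 0 < s'.q ∧ s'.q < 1 ∧ ∃ g : ℝ, 0 < g ∧ g < 1 ∧ s'.ρ = SP[lo, K, g] ∧
        2 * (lo : ℝ) ≤ s'.q * ((lo : ℝ) + K * g) ∧ x ≤ s'.q * g := fun s' h' => hL s' (List.mem_cons_of_mem s h')
    obtain ⟨q, x₁, n, M, ρ⟩ := s
    simp only at hM hq0 hq1 hρ hm hxg
    subst hM
    subst hρ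
    -- parameters of the glued sibling
    set m : ℝ := q * ((lo : ℝ) + K * g) with hmdef
    set α : ℝ := ((lo : ℝ) + K) * (1 - q) / (((lo : ℝ) + K) - m) with hα
    set γ : ℝ := (m - lo) / K with hγ
    set θs : ℝ := m / ((lo : ℝ) + K) with hθs
    obtain ⟨_, hα0, hα1, hbigs, hθs1, hxθs, hloγ, hγ1, hxP⟩ := shapeSib_params_long lo K hloK hq0 hq1 hg1 hm hxg
    have hθs0 : 0 ≤ θs := le_trans hx0.le hxθs
    have hQ : ∀ γ' ∈ γ :: P, (lo : ℝ) ≤ K * γ' ∧ γ' < 1 ∧ x * ((lo : ℝ) + K) ≤ lo + K * γ' := by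
      intro γ' h'
      rcases List.mem_cons.1 h' with rfl | h'
      · exact ⟨hloγ, hγ1, hxP⟩
      · exact hP γ' h'
    obtain ⟨⟨a0, aM, a1, am⟩, _, a3⟩ := shapeForest_inv_long5 lo K hloK hK4 hx0 hx1 L hL' P hP hlenL
    obtain ⟨⟨b0, bM, b1, bm⟩, b2, _⟩ :=
      shapeForest_inv_long5 lo K hloK hK4 hx0 hx1 L hL' (γ :: P) hQ (by simpa only [List.length_cons] using hlenQ)
    obtain ⟨hft, hfm⟩ := shapeSibs_ftop_fmean lo K L hL'
    obtain ⟨hlo', _⟩ := shape_sum_bounds lo K x P (fun γ' h => ⟨(hP γ' h).2.1, (hP γ' h).2.2⟩)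
    set N : ℕ := (lo + K) * P.length + ftop L with hN
    set G : ℕ → ℝ := lconv ((lo + K) * P.length) (ftop L) (sHub lo K P) (flaw L) with hG
    set X₁ : ℕ → ℝ := lconv N (lo + K) G (gate δ[lo + K] θs) with hX₁
    set X₂ : ℕ → ℝ := lconv ((lo + K) * P.length + (lo + K)) (ftop L) (sHub lo K (γ :: P)) (flaw L) with hX₂
    have hsmean : Sib.mean ⟨q, x₁, n, lo + K, SP[lo, K, g]⟩ = (lo : ℝ) + K * g := (sp_laws lo K hg0.le hg1.le).2.2.2
    have eflaw : flaw (⟨q, x₁, n, lo + K, SP[lo, K, g]⟩ :: L) = lconv (ftop L) (lo + K) (flaw L) (gate SP[lo, K, g] q) := rfl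
    have eftop : ftop (⟨q, x₁, n, lo + K, SP[lo, K, g]⟩ :: L) = ftop L + (lo + K) := rfl
    have efmean : fmean (⟨q, x₁, n, lo + K, SP[lo, K, g]⟩ :: L) = fmean L + m := by
      show fmean L + q * Sib.mean ⟨q, x₁, n, lo + K, SP[lo, K, g]⟩ = _; rw [hsmean]
    rw [eflaw, eftop, efmean]
    simp only [List.length_cons] at b0 bM b1 bm b2
    rw [show (lo + K) * (P.length + 1) = (lo + K) * P.length + (lo + K) by ring] at b0 bM b1 bm b2
    rw [show (lo + K) * P.length + (lo + K) + ftop L = N + (lo + K) by rw [hN]; ring] at bM b1 bm b2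
    -- the mixture identity
    have hmix : ∀ h, lconv ((lo + K) * P.length) (ftop L + (lo + K)) (sHub lo K P) (lconv (ftop L) (lo + K) (flaw L) (gate SP[lo, K, g] q)) h
        = α * X₁ h + (1 - α) * X₂ h := by
      intro h
      rw [lconv_assoc, lconv_mix_right _ _ _ _ _ _ α (fun k => gate_shapeSib_eq_mix lo K hlo hK1 hq1 hg0.le hg1.le k) h, hX₁, hX₂,
        ← shapeForest_piece lo K P L γ]
    have eNt : (lo + K) * P.length + (ftop L + (lo + K)) = N + (lo + K) := by rw [hN]; ring
    rw [eNt]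
    -- laws of `X₁`
    obtain ⟨bl0, _, bl1, blm⟩ := gateBlob_laws (lo + K) hθs0 hθs1.le
    obtain ⟨c0, cM, c1, cm⟩ := lconv_laws a0 a1 am bl0 bl1 blm
    have hX₁s : SDEC x (N + (lo + K)) X₁ := a3 θs hbigs hθs1 hxθs
    have eθm : (((lo + K : ℕ)) : ℝ) * θs = m := by rw [hθs]; push_cast; field_simp
    have eγm : (lo : ℝ) + K * γ = m := by rw [hγ]; field_simp; ring
    have cm' : ∑ h ∈ Finset.range (N + (lo + K) + 1), (h : ℝ) * X₁ h = (P.map (fun γ => (lo : ℝ) + K * γ)).sum + (fmean L + m) := by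
      rw [hX₁, cm, eθm]; ring
    have bm' : ∑ h ∈ Finset.range (N + (lo + K) + 1), (h : ℝ) * X₂ h = (P.map (fun γ => (lo : ℝ) + K * γ)).sum + (fmean L + m) := by
      rw [hX₂, bm]; simp only [List.map_cons, List.sum_cons]; rw [eγm]; ring
    have main : ((∀ h, 0 ≤ lconv ((lo + K) * P.length) (ftop L + (lo + K)) (sHub lo K P) (lconv (ftop L) (lo + K) (flaw L) (gate SP[lo, K, g] q)) h) ∧
        (∀ h, N + (lo + K) < h →
          lconv ((lo + K) * P.length) (ftop L + (lo + K)) (sHub lo K P) (lconv (ftop L) (lo + K) (flaw L) (gate SP[lo, K, g] q)) h = 0) ∧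
        ∑ h ∈ Finset.range (N + (lo + K) + 1),
          lconv ((lo + K) * P.length) (ftop L + (lo + K)) (sHub lo K P) (lconv (ftop L) (lo + K) (flaw L) (gate SP[lo, K, g] q)) h = 1 ∧
        ∑ h ∈ Finset.range (N + (lo + K) + 1),
          (h : ℝ) * lconv ((lo + K) * P.length) (ftop L + (lo + K)) (sHub lo K P) (lconv (ftop L) (lo + K) (flaw L) (gate SP[lo, K, g] q)) h
          = (P.map (fun γ => (lo : ℝ) + K * γ)).sum + (fmean L + m)) ∧
        SDEC x (N + (lo + K)) (lconv ((lo + K) * P.length) (ftop L + (lo + K)) (sHub lo K P) (lconv (ftop L) (lo + K) (flaw L) (gate SP[lo, K, g] q))) := by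
      by_cases hcorner : P = [] ∧ L = []
      · -- one glued sibling alone
        obtain ⟨rfl, rfl⟩ := hcorner
        obtain ⟨t0, tM, t1, tm⟩ := shapeSib_laws lo K hq0.le hq1.le hg0.le hg1.le
        have e1 : lconv (ftop []) (lo + K) (flaw []) (gate SP[lo, K, g] q) = gate SP[lo, K, g] q := funext fun h => lconv_delta_left 0 _ _ tM h
        have eidx : ftop ([] : List Sib) + (lo + K) = lo + K := by show 0 + (lo + K) = lo + K; omega
        rw [eidx]
        have e2 : lconv ((lo + K) * ([] : List ℝ).length) (lo + K) (sHub lo K []) (gate SP[lo, K, g] q) = gate SP[lo, K, g] q :=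
          funext fun h => lconv_delta_left _ _ _ tM h
        have hN3 : N + (lo + K) = lo + K := by rw [hN]; simp [ftop]
        rw [e1, e2, hN3]
        refine ⟨⟨t0, tM, t1, by rw [tm, hmdef]; simp [fmean]⟩, sdec_shapeSib lo K hlo hK1 hx0 hq0 hq1 hg1 hxg⟩
      · have hcond : (γ :: P).length ≠ 1 ∨ L ≠ [] := by
          by_cases hPn : P = []
          · exact Or.inr (fun hLn => hcorner ⟨hPn, hLn⟩)
          · left; simp only [List.length_cons]; intro h; exact hPn (List.length_eq_zero_iff.1 (by omega))
        have hX₂s : SDEC x (N + (lo + K)) X₂ := b2 hcond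
        obtain ⟨r0, rM, r1, rm, rS⟩ := sdec_mix_laws hα0 hα1 hmix c0 cM c1 cm' b0 bM b1 bm' hX₁s hX₂s
        exact ⟨⟨r0, rM, r1, rm⟩, rS⟩
    obtain ⟨⟨r0, rM, r1, rm⟩, rS⟩ := main
    refine ⟨⟨r0, rM, r1, rm⟩, fun _ => rS, fun θ hθ hθ1 hxθ => ?_⟩
    have hta : x * ((N + (lo + K) : ℕ) : ℝ) ≤ (P.map (fun γ => (lo : ℝ) + K * γ)).sum + (fmean L + m) := by
      rw [hN]; push_cast
      have h1 : x * ((ftop L : ℕ) : ℝ) ≤ fmean L := hfm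
      have h2 : x * ((lo : ℝ) + K) ≤ m := by rw [← eγm]; exact hxP
      have e : x * (((lo : ℝ) + K) * (P.length : ℝ) + (ftop L : ℕ) + ((lo : ℝ) + K))
          = x * ((lo : ℝ) + K) * (P.length : ℝ) + x * ((ftop L : ℕ) : ℝ) + x * ((lo : ℝ) + K) := by ring
      rw [e]; linarith [hlo', h1, h2]
    exact (sdec_blob_step (lo + K) hx0 hx1 hxθ hθ1.le r0 rM r1 rm hta rS).2.2.2.2

/-- **EVERY FOREST OF AT MOST FIVE GLUED SIBLINGS `R^lo[qᵢ](R^K[gᵢ])` OF A COMMON SHAPE `lo < K ≤ 4lo` IS SDEC AT EVERY FLOOR `x ≤ min qᵢgᵢ` —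
ORACLE-FREE**, in the far-giant regime `mᵢ = qᵢ(lo + Kgᵢ) ≥ 2lo` (every sibling heavy-unfloored).  The sibling data: `s = ⟨q, ·, ·, lo+K, S(g)⟩`,
`S(g) = {lo: 1−g, lo+K: g}` (`= slice δ_lo K g`, arm-1 g49's `gluedSib lo K q g ·`). [this work] -/
theorem sdec_shapeForest_long5 (lo K : ℕ) (hloK : lo < K) (hK4 : K ≤ 4 * lo) {x : ℝ} (hx0 : 0 < x) (L : List Sib) (hL5 : L.length ≤ 5)
    (hL : ∀ s ∈ L, s.M = lo + K ∧ 0 < s.q ∧ s.q < 1 ∧ ∃ g : ℝ, 0 < g ∧ g < 1 ∧ s.ρ = SP[lo, K, g] ∧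
      2 * (lo : ℝ) ≤ s.q * ((lo : ℝ) + K * g) ∧ x ≤ s.q * g) :
    SDEC x (ftop L) (flaw L) := by
  by_cases hnil : L = []
  · subst hnil; intro q _ _ j' hj'; exact absurd hj' (Nat.not_lt_zero _)
  · obtain ⟨s, hs⟩ := List.exists_mem_of_ne_nil L hnil
    have hx1 : x < 1 := by
      obtain ⟨_, hq0, hq1, g, hg0, hg1, _, _, hxg⟩ := hL s hs
      nlinarith
    have hLaw : ∀ s ∈ L, s.LawOK := by
      intro s hs
      obtain ⟨hM, hq0, hq1, g, hg0, hg1, hρ, _, _⟩ := hL s hs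
      obtain ⟨c0, cM, c1, _⟩ := sp_laws lo K hg0.le hg1.le
      refine ⟨hq0, hq1, ?_, ?_, ?_⟩
      · intro h; rw [hρ]; exact c0 h
      · intro h hh; rw [hρ]; exact cM h (by rw [hM] at hh; exact hh)
      · rw [hM, hρ]; exact c1
    obtain ⟨_, fM, _, _⟩ := flaw_facts L hLaw
    have h := (shapeForest_inv_long5 lo K hloK hK4 hx0 hx1 L hL [] (fun γ h => by simp at h) (by simpa using hL5)).2.1 (Or.inl (by simp))
    have e : lconv ((lo + K) * ([] : List ℝ).length) (ftop L) (sHub lo K []) (flaw L) = flaw L := funext fun k => lconv_delta_left _ _ _ fM k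
    rw [e] at h
    simpa using h

/-! ### Any parameters: light glued siblings are tame -/

/-- **AT MOST FIVE HEAVY GLUED SIBLINGS OF ONE SHAPE `lo < K ≤ 4lo` PLUS ANY NUMBER OF LIGHT ONES ARE SDEC AT EVERY TREE-OK FLOOR.**  `Lh`: `≤ 5`
siblings `⟨q,·,·,lo+K,S(g)⟩` with `q(lo+Kg) ≥ 2lo`; `Lt`: any list of siblings of the same shape with `q(lo+Kg) < 2lo` (tame, arm-1 g57's
`sdec_cons_of_tame` / `sdec_append_tame`); all with `0 < q, g < 1`, `x ≤ qg`; `0 < x` ⟹ `SDEC x (ftop (Lt ++ Lh)) (flaw (Lt ++ Lh))` (any order by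
`sdec_flaw_perm`). [this work] -/
theorem sdec_shapeForest_long5_append (lo K : ℕ) (hloK : lo < K) (hK4 : K ≤ 4 * lo) {x : ℝ} (hx0 : 0 < x) (Lh Lt : List Sib)
    (hLh5 : Lh.length ≤ 5)
    (hLh : ∀ s ∈ Lh, s.M = lo + K ∧ 0 < s.q ∧ s.q < 1 ∧ ∃ g : ℝ, 0 < g ∧ g < 1 ∧ s.ρ = SP[lo, K, g] ∧
      2 * (lo : ℝ) ≤ s.q * ((lo : ℝ) + K * g) ∧ x ≤ s.q * g)
    (hLt : ∀ s ∈ Lt, s.M = lo + K ∧ 0 < s.q ∧ s.q < 1 ∧ ∃ g : ℝ, 0 < g ∧ g < 1 ∧ s.ρ = SP[lo, K, g] ∧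
      s.q * ((lo : ℝ) + K * g) < 2 * lo ∧ x ≤ s.q * g) :
    SDEC x (ftop (Lt ++ Lh)) (flaw (Lt ++ Lh)) := by
  by_cases hnil : Lt ++ Lh = []
  · rw [hnil]; intro q _ _ j' hj'; exact absurd hj' (Nat.not_lt_zero _)
  obtain ⟨s₀, hs₀⟩ := List.exists_mem_of_ne_nil _ hnil
  have hx1 : x < 1 := by
    rcases List.mem_append.1 hs₀ with h | h
    · obtain ⟨_, hq0, hq1, g, hg0, hg1, _, _, hx⟩ := hLt s₀ h
      nlinarith
    · obtain ⟨_, hq0, hq1, g, hg0, hg1, _, _, hx⟩ := hLh s₀ h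
      nlinarith
  have hlo : 1 ≤ lo := by omega
  have fh : ∀ s ∈ Lh, s.LawOK ∧ x * (s.M : ℝ) ≤ s.q * s.mean ∧
      (∀ h : ℕ, 1 ≤ h → s.ρ h ≠ 0 → s.q * s.mean < 2 * lo → s.q * s.mean ≤ 2 * h) := by
    intro s hs
    obtain ⟨hM, hq0, hq1, g, hg0, hg1, hρ, _, hx⟩ := hLh s hs
    exact shapeSib_facts lo K hlo s ⟨hM, hq0, hq1, g, hg0, hg1, hρ, hx⟩
  have ft : ∀ s ∈ Lt, s.LawOK ∧ x * (s.M : ℝ) ≤ s.q * s.mean ∧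
      (∀ h : ℕ, 1 ≤ h → s.ρ h ≠ 0 → s.q * s.mean < 2 * lo → s.q * s.mean ≤ 2 * h) := by
    intro s hs
    obtain ⟨hM, hq0, hq1, g, hg0, hg1, hρ, _, hx⟩ := hLt s hs
    exact shapeSib_facts lo K hlo s ⟨hM, hq0, hq1, g, hg0, hg1, hρ, hx⟩
  have hSh : SDEC x (ftop Lh) (flaw Lh) := sdec_shapeForest_long5 lo K hloK hK4 hx0 Lh hLh5 hLh
  refine sdec_append_tame hx0 hx1 Lh (fun t ht => (fh t ht).1) (fun t ht => (fh t ht).2.1) hSh Lt (fun s hs => (ft s hs).1)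
    (fun s hs => (ft s hs).2.1) ?_
  intro s hs h h1 hh
  have hlt : s.q * s.mean < 2 * lo := by
    obtain ⟨hM, _, _, g, hg0, hg1, hρ, hlt, _⟩ := hLt s hs
    obtain ⟨_, _, _, cm⟩ := sp_laws lo K hg0.le hg1.le
    have hmean : s.mean = (lo : ℝ) + K * g := by unfold Sib.mean; rw [hM, hρ]; exact cm
    rw [hmean]; exact hlt
  exact Or.inl ((ft s hs).2.2 h h1 hh hlt)

/-- **EVERY FOREST OF AT MOST FIVE GLUED SIBLINGS `R^lo(R^K)` OF ONE SHAPE `lo < K ≤ 4lo` IS SDEC AT EVERY TREE-OK FLOOR — ANY PARAMETERS, NO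
ORACLE.**  For every list `L` of `≤ 5` siblings `⟨q,·,·,lo+K,{lo: 1−g, lo+K: g}⟩` with `0 < q, g < 1` and every floor `0 < x ≤ min qᵢgᵢ`:
`SDEC x (ftop L) (flaw L)`.  Heavy siblings (`q(lo+Kg) ≥ 2lo`) by the expansion `sdec_shapeForest_long`, light ones are tame (`sdec_append_tame`).
(`sdec_shapeForests_four_long`: `≤ 4`.) [this work] -/
theorem sdec_shapeForests_five_long (lo K : ℕ) (hloK : lo < K) (hK4 : K ≤ 4 * lo) {x : ℝ} (hx0 : 0 < x) (L : List Sib) (hL5 : L.length ≤ 5)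
    (hL : ∀ s ∈ L, s.M = lo + K ∧ 0 < s.q ∧ s.q < 1 ∧ ∃ g : ℝ, 0 < g ∧ g < 1 ∧ s.ρ = SP[lo, K, g] ∧ x ≤ s.q * g) :
    SDEC x (ftop L) (flaw L) := by
  classical
  have hsplit : ∀ s ∈ L, ∃ g : ℝ, s.M = lo + K ∧ 0 < s.q ∧ s.q < 1 ∧ 0 < g ∧ g < 1 ∧ s.ρ = SP[lo, K, g] ∧ x ≤ s.q * g ∧
      s.mean = (lo : ℝ) + K * g := by
    intro s hs
    obtain ⟨hM, hq0, hq1, g, hg0, hg1, hρ, hx⟩ := hL s hs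
    obtain ⟨_, _, _, cm⟩ := sp_laws lo K hg0.le hg1.le
    exact ⟨g, hM, hq0, hq1, hg0, hg1, hρ, hx, by unfold Sib.mean; rw [hM, hρ]; exact cm⟩
  set b : Sib → Bool := fun s => decide (2 * (lo : ℝ) ≤ s.q * s.mean) with hb
  set Lh := L.filter b with hLh
  set Lt := L.filter (fun s => !b s) with hLt
  have hperm : (Lt ++ Lh).Perm L := (List.perm_append_comm).trans (List.filter_append_perm b L)
  refine sdec_flaw_perm hperm ?_
  refine sdec_shapeForest_long5_append lo K hloK hK4 hx0 Lh Lt ((List.length_filter_le _ _).trans hL5) ?_ ?_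
  · intro s hs
    have hbs : 2 * (lo : ℝ) ≤ s.q * s.mean := by
      have := (List.mem_filter.1 hs).2
      simpa [hb] using this
    obtain ⟨g, hM, hq0, hq1, hg0, hg1, hρ, hx, hmean⟩ := hsplit s (List.mem_of_mem_filter hs)
    exact ⟨hM, hq0, hq1, g, hg0, hg1, hρ, by rw [← hmean]; exact hbs, hx⟩
  · intro s hs
    have hbs : s.q * s.mean < 2 * lo := by
      have := (List.mem_filter.1 hs).2
      simp [hb] at this
      exact this
    obtain ⟨g, hM, hq0, hq1, hg0, hg1, hρ, hx, hmean⟩ := hsplit s (List.mem_of_mem_filter hs)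
    exact ⟨hM, hq0, hq1, g, hg0, hg1, hρ, by rw [← hmean]; exact hbs, hx⟩

/-! ### At most five tight siblings: `lo < K ≤ 4lo` -/

/-- **EVERY ONE-SHAPE FOREST OF GLUED SIBLINGS `R^lo(R^K)`, `lo < K ≤ 4lo`, WITH AT MOST FIVE TIGHT SIBLINGS IS SDEC — ANY PARAMETERS, EVERY WIDTH,
NO ORACLE.**  Glued siblings `⟨q,·,·,lo+K,{lo: 1−g, lo+K: g}⟩` with `0 < q, g < 1`, `x ≤ qg`, `0 < x`, and
`(L.filter (2lo < q·mean < lo + K·x)).length ≤ 5`: the tight core (heavy) by `sdec_shapeForest_long5`, the rest tame (gen 34's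
`sdec_shapeForests_of_tightCore`). [this work] -/
theorem sdec_shapeForests_long_of_fiveTight (lo K : ℕ) (hloK : lo < K) (hK4 : K ≤ 4 * lo) {x : ℝ} (hx0 : 0 < x) (L : List Sib)
    (hL : ∀ s ∈ L, s.M = lo + K ∧ 0 < s.q ∧ s.q < 1 ∧ ∃ g : ℝ, 0 < g ∧ g < 1 ∧ s.ρ = SP[lo, K, g] ∧ x ≤ s.q * g)
    (hfew : (L.filter (fun s => decide (2 * (lo : ℝ) < s.q * s.mean ∧ s.q * s.mean < (lo : ℝ) + K * x))).length ≤ 5) :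
    SDEC x (ftop L) (flaw L) := by
  have hlo : 1 ≤ lo := by omega
  refine sdec_shapeForests_of_tightCore lo K hlo hx0 L hL (sdec_shapeForest_long5 lo K hloK hK4 hx0 _ hfew fun s hs => ?_)
  have ht : 2 * (lo : ℝ) < s.q * s.mean ∧ s.q * s.mean < (lo : ℝ) + K * x := by
    have hb := (List.mem_filter.1 hs).2
    simpa using hb
  obtain ⟨hM, hq0, hq1, g, hg0, hg1, hρ, hx⟩ := hL s (List.mem_of_mem_filter hs)
  obtain ⟨_, _, _, cm⟩ := sp_laws lo K hg0.le hg1.le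
  have hmean : s.mean = (lo : ℝ) + K * g := by unfold Sib.mean; rw [hM, hρ]; exact cm
  exact ⟨hM, hq0, hq1, g, hg0, hg1, hρ, by rw [← hmean]; exact ht.1.le, hx⟩

/-- **THE SIBLING STEP FOR GOOD SIBLINGS + GLUED SIBLINGS OF ONE SHAPE `lo < K ≤ 4lo` WITH AT MOST FIVE TIGHT ONES — NO ORACLE.**  For `0 < x < 1`,
any list `Lg` of siblings GOOD at `x` (law-OK, `x·M ≤ q·mean`, tame or hull+high — any sub-trees), any list `Lc` of glued siblings
`⟨q,·,·,lo+K,{lo: 1−g, lo+K: g}⟩` (`0 < q, g < 1`, `x ≤ qg`) whose tight part has length `≤ 5`, and every forest `L ~ Lg ++ Lc`: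
`SDEC x (ftop L) (flaw L)` (`sdec_forest_fourTightCore`: `≤ 4`). [this work] -/
theorem sdec_forest_fiveTightCore (lo K : ℕ) (hloK : lo < K) (hK4 : K ≤ 4 * lo) {x : ℝ} (hx0 : 0 < x) (hx1 : x < 1) (Lg Lc L : List Sib)
    (hLg : ∀ s ∈ Lg, s.LawOK ∧ x * (s.M : ℝ) ≤ s.q * s.mean ∧
      ((∀ h : ℕ, 1 ≤ h → s.ρ h ≠ 0 → s.q * s.mean ≤ 2 * h ∨ x * ((s.M : ℝ) - h) ≤ s.q * s.mean - h) ∨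
        HullHigh x (s.q * s.mean) s.M (gate s.ρ s.q)))
    (hLc : ∀ s ∈ Lc, s.M = lo + K ∧ 0 < s.q ∧ s.q < 1 ∧ ∃ g : ℝ, 0 < g ∧ g < 1 ∧ s.ρ = SP[lo, K, g] ∧ x ≤ s.q * g)
    (hcore : (Lc.filter (fun s => decide (2 * (lo : ℝ) < s.q * s.mean ∧ s.q * s.mean < (lo : ℝ) + K * x))).length ≤ 5)
    (hperm : (Lg ++ Lc).Perm L) :
    SDEC x (ftop L) (flaw L) := by
  have hlo : 1 ≤ lo := by omega
  have fc : ∀ s ∈ Lc, s.LawOK ∧ x * (s.M : ℝ) ≤ s.q * s.mean := fun s hs =>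
    ⟨(shapeSib_facts lo K hlo s (hLc s hs)).1, (shapeSib_facts lo K hlo s (hLc s hs)).2.1⟩
  have hSc : SDEC x (ftop Lc) (flaw Lc) := sdec_shapeForests_long_of_fiveTight lo K hloK hK4 hx0 Lc hLc hcore
  refine sdec_flaw_perm hperm ?_
  exact sdec_append_good hx0 hx1 Lc (fun t ht => (fc t ht).1) (fun t ht => (fc t ht).2) hSc Lg (fun s hs => (hLg s hs).1)
    (fun s hs => (hLg s hs).2.1) (fun s hs => (hLg s hs).2.2)

end LawDec
end Quant
end Summit.CriticalPhenomena.PercolationContinuityZ3.Theorems
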